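import Summits.BirchSwinnertonDyer.BirchSwinnertonDyer.Theorems.ByReductionTypeAtTwoRankOneAtTwoOneDoorFirstDescentDefs
import Summits.BirchSwinnertonDyer.BirchSwinnertonDyer.Theorems.ByReductionTypeAtTwoRankOneAtTwoBigImageOddLocalOneDoorBottomHeegnerClass
import Summits.BirchSwinnertonDyer.BirchSwinnertonDyer.Theorems.ByReductionTypeAtTwoRankOneAtTwoBigImageOddLocalOneDoorBottomLeavesLines
import Summits.BirchSwinnertonDyer.BirchSwinnertonDyer.Theorems.ByReductionTypeAtTwoRankOneAtTwoBigImageOddLocalOneDoorBottomLeavesRec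
import Summits.BirchSwinnertonDyer.BirchSwinnertonDyer.Theorems.ByReductionTypeAtTwoRankOneAtTwoBigImageOddLocalOneDoorBottomCebotarev
import Summits.BirchSwinnertonDyer.BirchSwinnertonDyer.Theorems.ByReductionTypeAtTwoRankOneAtTwoBigImageOddLocalOneDoorHalvesJointDoor
import Summits.BirchSwinnertonDyer.BirchSwinnertonDyer.Theorems.GenusKolyvaginAtTwoEquivariantKolyvaginExactAtTwoPairBookkeeping
import Literature.NumberTheory.EllipticCurves.ArtinFormalismQuadraticLocalProofs
import Literature.NumberTheory.EllipticCurves.HidaFamilyMembersProofs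
import Literature.NumberTheory.EllipticCurves.PointDivisibilityProofs
import HarnessLib

/-!
# Route ByReductionTypeAtTwo, crux `RankOneAtTwoBigImageOddLocal` (stmt-BirchSwinnertonDyer-23715), LINE v8.10 `one_door_analytic`:
# ASSEMBLY of the first-descent input at `Δ_W < 0` — `FirstDescentInput W Wd` from the first-layer classes

Lead prover seat `bsd-line-fkl-p1` g12 (2026-08-28), `--supports stmt-BirchSwinnertonDyer-23715` (helper).  THEOREMS ONLY; no
definition, no named fact introduced, no `sorry`; BSD is not proved by any of this.

At a bottom-rung datum with `Δ_W < 0` (minimal door: one transposition prime `q₀`, no identity prime; odd constant; `m = 0`) the record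
`FirstDescentInput W Wd` (`Theorems/…OneDoorFirstDescentDefs.lean`) is BUILT from:
* the error place `q₀ = v_{q₀}` extracted from `transpCount = 1` (`q₀ ∣ d_K`, `(Δ_min/q₀) = −1`, odd, good), the Kolyvagin primes
  `KolNeg W K` (Gross's primes at `M = 2` in the currency of the Čebotarev leaves), `pl = plOfNat`;
* the Heegner class `y = κ_ℚ(g)` (`exists_heegnerClass_at`, `…OneDoorBottomHeegnerClass.lean`);
* the width seat fkl-p2 g10's leaves: `line₁_inl`, `line₂_inl` (`…OneDoorBottomLeavesLines.lean`), `rec₁_inl`, `rec₂_inl`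
  (`…OneDoorBottomLeavesRec.lean`), `ceb₁_rat`, `ceb₂_rat` with `hinjK_of_habitat` (`…OneDoorBottomCebotarev.lean`; the habitat binder
  `¬ IsSquare (d_K · (−|Δ_W|))` is `kolyvaginAdmissible_of_doorAdmissible`);
* TWO displayed inputs: the first-layer classes `FirstLayerClasses W Wd q₀ (KolNeg W K) plOfNat y` (route GenusKolyvaginAtTwo's item 24880
  at `(M, m, l) = (1, 1, ℓ)` + descent — `hcl`), and the CROSS Čebotarev field for `Wd` (`hcross`; the generic case is fkl-p2's `ceb₂'_rat`,
  the «twin copy of `y`» case is the lead's `hceb₂_of_visible₂` over gk2's local transfer — being filed by the width seat).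

Main theorem: `nonempty_firstDescentInput_neg`.  Corollary shape for the skeleton v8.10 (once `hcross` is a tree theorem):
`FirstDescentLeavesAtTwoBottomNeg ⟸ FirstLayerClassesAtTwoBottomNeg` + the four primary printed facts.

References: [GrossLMS1991] §§3, 6, 9, 10; [McCallumLMS1991] Cor. 3.2, Prop. 4.4, Lemma 5.3; [MazurRubin2010] Lemmas 2.2, 2.10;
[Kramer1981] Prop. 3; [Kolyvagin1989Izv] §3.
-/

set_option autoImplicit false
-- the Theorems namespace of this sub repeats the summit name by design (D-0017 nested layout)
set_option linter.dupNamespace false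

noncomputable section

open scoped Classical

namespace Summit.BirchSwinnertonDyer.BirchSwinnertonDyer.Theorems.RankOneAtTwoOneDoor

open WeierstrassCurve NumberField IsDedekindDomain Literature.NumberTheory.EllipticCurves Literature.NumberTheory.EllipticCurves.ModularForms
  Literature.NumberTheory.GaloisRepresentations Literature.NumberTheory.EllipticCurves.KrizLi2019
  Summit.BirchSwinnertonDyer.Rank1Residual.F1Sign2
  Summit.BirchSwinnertonDyer.Rank1Residual.F1Sign2.TranspositionDoor
  Summit.BirchSwinnertonDyer.BirchSwinnertonDyer.Theorems.GenusExact
  Summit.BirchSwinnertonDyer.BirchSwinnertonDyer.Theorems.GenusExact.VisiblePairAtTwo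

/-! ### §1 The transposition prime of a minimal door at `Δ_W < 0` -/

/-- **The transposition prime of a minimal door**: from `t = 1` there is a prime `q₀ ∣ d` with `(Δ_min/q₀) = −1`; for a door-admissible
`d` it is odd, of good reduction, and prime to `Δ_min`. [cite: Kramer1981, Prop. 3] [cite: MazurRubin2010, Lemma 2.2 (i)] -/
theorem exists_transpositionPrime (W : WeierstrassCurve ℚ) [W.IsElliptic] [W.IsGloballyMinimal] {d : ℤ} (hadm : DoorAdmissible W d)
    (ht : transpCount W d = 1) :
    ∃ (q₀ : ℕ) (hq₀ : q₀.Prime), (q₀ : ℤ) ∣ d ∧ jacobiSym W.Δ.num q₀ = -1 ∧ q₀ ≠ 2 ∧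
      (haveI : Fact q₀.Prime := ⟨hq₀⟩; W.HasGoodReductionAtPrime q₀) ∧ ¬ (q₀ : ℤ) ∣ W.Δ.num := by
  obtain ⟨hdneg, hsq, hd8, hgood, -⟩ := hadm
  unfold transpCount at ht
  obtain ⟨q₀, hq₀⟩ := Finset.card_eq_one.mp ht
  have hmem : q₀ ∈ d.natAbs.primeFactors.filter fun q => jacobiSym W.Δ.num q = -1 := by
    rw [hq₀]; exact Finset.mem_singleton_self _
  obtain ⟨hpf, hjac⟩ := Finset.mem_filter.mp hmem
  have hq₀p : q₀.Prime := Nat.prime_of_mem_primeFactors hpf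
  have hq₀d : (q₀ : ℤ) ∣ d := Int.ofNat_dvd_left.mpr (Nat.dvd_of_mem_primeFactors hpf)
  have hq₀2 : q₀ ≠ 2 := by
    rintro rfl
    have h2 : (2 : ℤ) ∣ d := by exact_mod_cast hq₀d
    omega
  have hqΔ : ¬ (q₀ : ℤ) ∣ W.Δ.num := by
    intro h
    have e : jacobiSym W.Δ.num q₀ = 0 := by
      rw [jacobiSym.mod_left, Int.emod_eq_zero_of_dvd h, jacobiSym.zero_left hq₀p.one_lt]
    rw [e] at hjac
    exact absurd hjac (by decide)
  exact ⟨q₀, hq₀p, hq₀d, hjac, hq₀2, hgood q₀ hq₀p hq₀d ⟨hq₀p⟩, hqΔ⟩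

/-! ### §2 The assembly at `Δ_W < 0` -/

/-- **`FirstDescentInput W Wd` at a bottom-rung datum with `Δ_W < 0`**, from the first-layer classes (`hcl`, route GenusKolyvaginAtTwo's
item 24880 at `(1, 1, ℓ)` + descent, in the shape of `FirstLayerClassesAtTwoBottomNeg`) and the cross Čebotarev field (`hcross`), every other
field being a tree theorem: error place `q₀ = v_{q₀}` (the transposition prime), `Kol = KolNeg W K`, `pl = plOfNat`, `y` from
`exists_heegnerClass_at`, `line₁`/`line₂`/`rec₁`/`rec₂`/`ceb₁`/`ceb₂` from the width seat's leaves on the habitat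
(`kolyvaginAdmissible_of_doorAdmissible`, `hinjK_of_habitat`, `exists_sq_eq_discr_not_mem_range`).  Modulo Gross–Zagier, Kolyvagin,
modularity, Hoffstein–Luo (ranks). [cite: GrossLMS1991, §10] [cite: McCallumLMS1991, Cor. 3.2, Lemma 5.3] [cite: Kolyvagin1989Izv, §3] -/
theorem nonempty_firstDescentInput_neg
    (hGZ : ∀ (N : ℕ) [NeZero N] (W : WeierstrassCurve ℚ) (K : Type) [Field K] [NumberField K], gross_zagier N W K)
    (hKo : ∀ (N : ℕ) [NeZero N] (W : WeierstrassCurve ℚ) (K : Type) [Field K] [NumberField K], kolyvagin N W K)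
    (hnf : exists_isNewformOf) (hHL : HoffsteinLuo1997_exists_twist_L_one_ne_zero)
    (W : WeierstrassCurve ℚ) [W.IsElliptic] [W.IsGloballyMinimal] [NeZero (W.conductorNorm ℤ)]
    (hCM : ¬ W.HasCM) (hsurj : ∀ n : ℕ, W.HasSurjectiveModNGaloisRep ((2 ^ n : ℕ) : ℤ)) (hT : Odd W.torsionOrder)
    (hr : W.analyticRank = 1)
    (K : Type) [Field K] [NumberField K] (hK : IsImaginaryQuadratic K)
    (hadm : DoorAdmissible W (NumberField.discr K))
    (hLt : (W.quadraticTwist (NumberField.discr K : ℚ)).entireLFunction 1 ≠ 0)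
    (Dt : ModularParametrizationData W (W.conductorNorm ℤ))
    (H : HeegnerDatum (W.conductorNorm ℤ) (NumberField.discr K)) (ι : K →+* ℂ)
    (P : (W.baseChange K).toAffine.Point)
    (hP : WeierstrassCurve.Affine.Point.map ι.toRatAlgHom P = heegnerPointComplex Dt H)
    (Wd : WeierstrassCurve ℚ) [Wd.IsElliptic] [Wd.IsGloballyMinimal] (Cd : WeierstrassCurve.VariableChange ℚ)
    (hWd : Cd • W.quadraticTwist (NumberField.discr K : ℚ) = Wd)
    (hmin : transpCount W (NumberField.discr K) + 2 * identCount W (NumberField.discr K) = (if W.Δ < 0 then 1 else 0))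
    (hm : HasTwoDivisibilityUpToTorsion W K P 0) (hΔ : W.Δ < 0)
    (hcl : ∀ (q₀ : ℕ) (hq₀ : q₀.Prime), (q₀ : ℤ) ∣ NumberField.discr K → jacobiSym W.Δ.num q₀ = -1 →
      ∀ (hdivK : ∀ Q : geomPoints (W.baseChange K), ∃ R : geomPoints (W.baseChange K), (2 : ℤ) • R = Q)
        (y : galH1Torsion W 2), y ∈ selmerGroup W 2 → resTorsion W K 2 y = kummerMapTorsion (W.baseChange K) 2 hdivK P →
        Nonempty (FirstLayerClasses W Wd (Sum.inl (Rat.HeightOneSpectrum.primesEquiv.symm ⟨q₀, hq₀⟩)) (KolNeg W K) plOfNat y))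
    (hcross : ∀ (q₀ : RatPlace) (y : galH1Torsion W 2) (s : galH1Torsion Wd 2), y ≠ 0 → s ≠ 0 →
      (∀ w : RatPlace, w ≠ q₀ → s ∈ locAt Wd 2 w) →
      ∃ ℓ, KolNeg W K ℓ ∧ s ∉ strictAt Wd 2 (plOfNat ℓ) ∧ y ∉ strictAt W 2 (plOfNat ℓ)) :
    Nonempty (FirstDescentInput W Wd) := by
  haveI hEK : (W.baseChange K).IsElliptic := isElliptic_baseChange' W K
  have h2K : Module.finrank ℚ K = 2 := hK.1
  have hD0 : (NumberField.discr K : ℚ) ≠ 0 := by exact_mod_cast NumberField.discr_ne_zero K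
  -- habitat bookkeeping
  obtain ⟨hdodd, -, hns, -⟩ := kolyvaginAdmissible_of_doorAdmissible W hadm
  obtain ⟨θ, hθ, hθsq⟩ := Literature.NumberTheory.EllipticCurves.exists_sq_eq_discr_not_mem_range K h2K
  have hinjK := hinjK_of_habitat W K hK hΔ hsurj hns
  -- the transposition prime `q₀` and its place `v₀`
  obtain ⟨ht, -⟩ := (minimal_iff_of_neg W _ hΔ).mp hmin
  obtain ⟨q₀, hq₀p, hq₀d, hjac, hq₀2, hgood₀, hqΔ⟩ := exists_transpositionPrime W hadm ht
  haveI : Fact q₀.Prime := ⟨hq₀p⟩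
  set v₀ : HeightOneSpectrum (𝓞 ℚ) := Rat.HeightOneSpectrum.primesEquiv.symm ⟨q₀, hq₀p⟩ with hv₀
  have hq₀v : (q₀ : 𝓞 ℚ) ∈ v₀.asIdeal := natCast_mem_primesEquiv_symm hq₀p
  -- `2`-divisibility of geometric points
  have hdivQ : ∀ Q : geomPoints W, ∃ R : geomPoints W, (2 : ℤ) • R = Q :=
    fun Q => W.zsmul_geomPoints_surjective_holds two_ne_zero Q
  have hdivK : ∀ Q : geomPoints (W.baseChange K), ∃ R : geomPoints (W.baseChange K), (2 : ℤ) • R = Q :=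
    fun Q => (W.baseChange K).zsmul_geomPoints_surjective_holds two_ne_zero Q
  -- the Heegner class `y`
  obtain ⟨y, hymem, hy0, hyres⟩ := exists_heegnerClass_at hGZ hKo hnf hHL W hT hr K hK hadm hLt Dt H ι P hP hm hdivQ hdivK
  -- the first-layer classes (displayed input)
  obtain ⟨cl⟩ := hcl q₀ hq₀p hq₀d hjac hdivK y hymem hyres
  -- bookkeeping at a Kolyvagin prime
  have hKolFacts : ∀ ℓ, KolNeg W K ℓ → ∃ hℓ : ℓ.Prime, ℓ ≠ 2 ∧ ¬ ((ℓ : ℤ) ∣ NumberField.discr K) ∧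
      (haveI : Fact ℓ.Prime := ⟨hℓ⟩; W.HasGoodReductionAtPrime ℓ) ∧ FrobEqFrobInfty W K 2 ℓ ∧ 1 ≤ Zhang2014.kolyvaginIndex W 2 ℓ ∧
      plOfNat ℓ = Sum.inl (Rat.HeightOneSpectrum.primesEquiv.symm ⟨ℓ, hℓ⟩) ∧
      (ℓ : 𝓞 ℚ) ∈ (Rat.HeightOneSpectrum.primesEquiv.symm ⟨ℓ, hℓ⟩ : HeightOneSpectrum (𝓞 ℚ)).asIdeal ∧
      v₀ ≠ Rat.HeightOneSpectrum.primesEquiv.symm ⟨ℓ, hℓ⟩ := by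
    rintro ℓ ⟨hFrob, hKol, hidx⟩
    have hℓ : ℓ.Prime := hKol.1
    haveI : Fact ℓ.Prime := ⟨hℓ⟩
    have hℓN : ¬ ℓ ∣ W.conductorNorm ℤ := hKol.2.1
    have hℓd : ¬ ((ℓ : ℤ) ∣ NumberField.discr K) := hKol.2.2.1
    have hℓ2 : ℓ ≠ 2 := hKol.2.2.2.1
    refine ⟨hℓ, hℓ2, hℓd, hasGoodReductionAtPrime_of_not_dvd_conductorNorm W hℓN, hFrob, hidx, plOfNat_of_prime hℓ,
      natCast_mem_primesEquiv_symm hℓ, ?_⟩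
    intro hv
    -- `v₀ = v_ℓ` would give `ℓ = q₀ ∣ d_K`
    have hℓv₀ : (ℓ : 𝓞 ℚ) ∈ v₀.asIdeal := by rw [hv]; exact natCast_mem_primesEquiv_symm hℓ
    have hqℓ : v₀ = Rat.HeightOneSpectrum.primesEquiv.symm ⟨q₀, hq₀p⟩ := rfl
    have hℓq : ℓ = q₀ := by
      have h1 := (natCast_prime_mem_iff_eq hℓ v₀).mp hℓv₀
      have h2 := Rat.HeightOneSpectrum.primesEquiv.symm.injective (h1.symm.trans hqℓ)
      exact congrArg Subtype.val h2
    exact hℓd (hℓq ▸ hq₀d)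
  refine ⟨⟨Sum.inl v₀, KolNeg W K, plOfNat, y, hymem, hy0, cl.c₁, cl.c₂, cl.c₁_loc, cl.c₁_loc_iff, cl.c₂_loc, cl.c₂_loc_iff,
    ?_, ?_, ?_, ?_, ?_, ?_, ?_⟩⟩
  · -- rec₁
    intro ℓ hKol d hd hdv s hs hsv
    obtain ⟨hℓ, hℓ2, -, hgoodℓ, hFrob, hidx, hpl, hℓv, hne⟩ := hKolFacts ℓ hKol
    haveI : Fact ℓ.Prime := ⟨hℓ⟩
    rw [hpl] at hd hdv hsv
    exact rec₁_inl W hΔ hℓ2 hℓv hgoodℓ hFrob hidx v₀ hne d hd hdv s hs hsv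
  · -- rec₂
    intro ℓ hKol d hd hdv s hs hsv
    obtain ⟨hℓ, hℓ2, hℓd, hgoodℓ, hFrob, hidx, hpl, hℓv, hne⟩ := hKolFacts ℓ hKol
    haveI : Fact ℓ.Prime := ⟨hℓ⟩
    rw [hpl] at hd hdv hsv
    exact rec₂_inl W hΔ hK hdodd Wd (Cd := Cd) (by exact_mod_cast hWd) hℓ2 hℓd hgoodℓ hFrob hℓv hidx v₀ hne d hd hdv s hs hsv
  · -- ceb₁
    obtain ⟨ℓ, -, hFrob, hKol, hidx, hloc⟩ := ceb₁_rat (W.conductorNorm ℤ) W dvd_rfl hCM hΔ hK hdodd hns hsurj hθ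
      (by exact_mod_cast hθsq) hinjK y hy0 0
    refine ⟨ℓ, ⟨hFrob, hKol, hidx⟩, ?_⟩
    rw [plOfNat_of_prime hKol.1]
    exact hloc _ (natCast_mem_primesEquiv_symm hKol.1)
  · -- ceb₂
    intro s hs0 hsy _hs
    obtain ⟨ℓ, -, hFrob, hKol, hidx, hloc⟩ := ceb₂_rat (W.conductorNorm ℤ) W dvd_rfl hCM hΔ hK hdodd hns hsurj hθ
      (by exact_mod_cast hθsq) hinjK s y hs0 hy0 hsy 0
    refine ⟨ℓ, ⟨hFrob, hKol, hidx⟩, ?_⟩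
    rw [plOfNat_of_prime hKol.1]
    exact hloc _ (natCast_mem_primesEquiv_symm hKol.1)
  · -- ceb₂' (displayed input `hcross`)
    intro s hs0 hs
    exact hcross (Sum.inl v₀) y s hy0 hs0 hs
  · -- line₁
    exact line₁_inl W hq₀2 hgood₀ hqΔ hjac hq₀v
  · -- line₂
    exact line₂_inl W hq₀2 hgood₀ hqΔ hjac hq₀v hD0 Wd (C := Cd) hWd

end Summit.BirchSwinnertonDyer.BirchSwinnertonDyer.Theorems.RankOneAtTwoOneDoor

end
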